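import Mathlib
import HarnessLib
import Summits.Ventures.LatticeQCDFlow.Exactness.LatticeCoordAvg

/-!
# The tower property of coordinate averages, `A_{C'} ∘ A_C = A_{C'}` for `C ⊆ C'`, and its consequences: non-constancy is inherited by finer averages, variances decrease under averaging

HONEST FRAMING: exact (Metropolis-corrected) sampling algorithms for lattice gauge theory;
figures of merit are autocorrelation/cost numbers at stated couplings and volumes; no
continuum-physics claim.

Venture `LatticeQCDFlow` (cell pub-lqcd), topic `Exactness`; FANOUT row 7 (`s0-cpn-null`).  NEW WORK
of the cell over the tree's `Exactness/LatticeCoordAvg.lean` (coordinate averages `A_s` on a finite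
product of compact probability spaces: gluing two independent samples is measure preserving, Jensen
`(A_s H)² ≤ A_s(H²)`, `E[A_s G] = E[G]`); nothing is cited as a fact ([folklore]: the tower property
of conditional expectations along independent coordinates).  Use in this lineage's barrier leg
(`Exactness/SphereLOFlowEntropyFloorGerm.lean`): the block fluctuations `s_j = ∫|A_C V_j − ∫V_j|` of
the extensive entropy floor average over ALL corridor coordinates `C`; by the tower property they are
positive as soon as ANY coarser conditional expectation of the static block term — e.g. given the
block's own coordinates only, `A_{Λ∖B_j} V_j` — is non-constant, a purely local and flow-free
condition.

## Content

* §1 `piecewise_piecewise_of_subset` (gluing along `C` inside a gluing along `C' ⊇ C`),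
  **`coordAvg_coordAvg_of_subset`** (`A_{C'}(A_C G) = A_{C'} G` for `C ⊆ C'`, continuous `G`),
  `coordAvg_coordAvg_of_subset'` (`A_C(A_{C'} G) = A_{C'} G`).
* §2 **`exists_ne_coordAvg_of_subset`** — NON-CONSTANCY IS INHERITED DOWNWARD: if `A_{C'} G` takes two
  values and `C ⊆ C'`, then `A_C G` takes two values.
* §3 **`variance_coordAvg_le_of_subset`** — `Var(A_{C'} G) ≤ Var(A_C G)` for `C ⊆ C'` (Jensen), in
  particular `Var(A_C G) ≤ Var(G)`.

NOT CLAIMED: anything model-specific; `L²` (non-continuous) generality.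
-/

noncomputable section

namespace Summit.Ventures.LatticeQCDFlow.Exactness

open MeasureTheory Function Set

variable {ι : Type*} [Fintype ι] [DecidableEq ι]
variable {X : Type*} [MeasurableSpace X] [MetricSpace X] [CompactSpace X] [BorelSpace X]
variable (μ : Measure X) [IsProbabilityMeasure μ]

/-! ## §1 The tower property -/

section Tower

omit [Fintype ι] [MeasurableSpace X] [MetricSpace X] [CompactSpace X] [BorelSpace X] in
/-- Gluing `ω''` along `C` into the configuration glued from `ω'` along `C' ⊇ C` is gluing
`C.piecewise ω'' ω'` along `C'`. -/
theorem piecewise_piecewise_of_subset {C C' : Finset ι} (hCC' : C ⊆ C') (ω ω' ω'' : ι → X) :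
    C.piecewise ω'' (C'.piecewise ω' ω) = C'.piecewise (C.piecewise ω'' ω') ω := by
  funext i
  by_cases hiC : i ∈ C
  · rw [Finset.piecewise_eq_of_mem _ _ _ hiC, Finset.piecewise_eq_of_mem _ _ _ (hCC' hiC),
      Finset.piecewise_eq_of_mem _ _ _ hiC]
  · rw [Finset.piecewise_eq_of_notMem _ _ _ hiC]
    by_cases hiC' : i ∈ C'
    · rw [Finset.piecewise_eq_of_mem _ _ _ hiC', Finset.piecewise_eq_of_mem _ _ _ hiC',
        Finset.piecewise_eq_of_notMem _ _ _ hiC]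
    · rw [Finset.piecewise_eq_of_notMem _ _ _ hiC', Finset.piecewise_eq_of_notMem _ _ _ hiC']

/-- **THE TOWER PROPERTY `A_{C'}(A_C G) = A_{C'} G` for `C ⊆ C'`** (continuous `G`): averaging first
over the coordinates in `C` and then over those in `C' ⊇ C` is averaging over `C'` (the two
independent samples glue to one, `map_piecewise_pi_prod`). -/
theorem coordAvg_coordAvg_of_subset {C C' : Finset ι} (hCC' : C ⊆ C') {G : (ι → X) → ℝ}
    (hG : Continuous G) (ω : ι → X) :
    coordAvg μ C' (coordAvg μ C G) ω = coordAvg μ C' G ω := by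
  have hglue : ∀ ω' ω'' : ι → X,
      G (C.piecewise ω'' (C'.piecewise ω' ω)) = G (C'.piecewise (C.piecewise ω'' ω') ω) :=
    fun ω' ω'' => by rw [piecewise_piecewise_of_subset hCC']
  -- joint continuity of the integrand in the two samples
  have hc2 : Continuous fun p : (ι → X) × (ι → X) => G (C'.piecewise (C.piecewise p.2 p.1) ω) :=
    hG.comp (((continuous_piecewise_prod C').comp
      ((Continuous.prodMk_right ω).comp (continuous_piecewise_prod C))))
  have hint : Integrable (fun p : (ι → X) × (ι → X) => G (C'.piecewise (C.piecewise p.2 p.1) ω))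
      ((Measure.pi (fun _ : ι => μ)).prod (Measure.pi (fun _ : ι => μ))) :=
    hc2.integrable_of_hasCompactSupport (HasCompactSupport.of_compactSpace _)
  have hcζ : Continuous fun ζ : ι → X => G (C'.piecewise ζ ω) :=
    hG.comp ((continuous_piecewise_prod C').comp (Continuous.prodMk_right ω))
  unfold coordAvg
  simp_rw [hglue]
  rw [← integral_prod _ hint]
  have hR : ∫ p : (ι → X) × (ι → X), G (C'.piecewise (C.piecewise p.2 p.1) ω)
      ∂(Measure.pi (fun _ : ι => μ)).prod (Measure.pi (fun _ : ι => μ)) =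
      ∫ ζ, G (C'.piecewise ζ ω) ∂Measure.map (fun p : (ι → X) × (ι → X) => C.piecewise p.2 p.1)
        ((Measure.pi (fun _ : ι => μ)).prod (Measure.pi (fun _ : ι => μ))) :=
    (integral_map (φ := fun p : (ι → X) × (ι → X) => C.piecewise p.2 p.1)
      (f := fun ζ => G (C'.piecewise ζ ω))
      (measurable_piecewise_prod C).aemeasurable hcζ.aestronglyMeasurable).symm
  rw [hR, map_piecewise_pi_prod μ C]

omit [MetricSpace X] [CompactSpace X] [BorelSpace X] [IsProbabilityMeasure μ] in
/-- **`A_C(A_{C'} G) = A_{C'} G` for `C ⊆ C'`**: `A_{C'} G` no longer depends on the coordinates in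
`C ⊆ C'`, so a further average over them does nothing. -/
theorem coordAvg_coordAvg_of_subset' [IsProbabilityMeasure μ] {C C' : Finset ι} (hCC' : C ⊆ C')
    (G : (ι → X) → ℝ) (ω : ι → X) :
    coordAvg μ C (coordAvg μ C' G) ω = coordAvg μ C' G ω := by
  have hinv : ∀ ω' : ι → X, coordAvg μ C' G (C.piecewise ω' ω) = coordAvg μ C' G ω := by
    intro ω'
    have h : C.piecewise ω' ω = C'.piecewise (C.piecewise ω' ω) ω := by
      funext i
      by_cases hiC' : i ∈ C'
      · rw [Finset.piecewise_eq_of_mem _ _ _ hiC']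
      · rw [Finset.piecewise_eq_of_notMem _ _ _ hiC',
          Finset.piecewise_eq_of_notMem _ _ _ (fun h => hiC' (hCC' h))]
    rw [h, coordAvg_apply_piecewise]
  change (∫ ω', coordAvg μ C' G (C.piecewise ω' ω) ∂Measure.pi (fun _ : ι => μ)) = coordAvg μ C' G ω
  simp_rw [hinv]
  rw [integral_const, smul_eq_mul, probReal_univ, one_mul]

end Tower

/-! ## §2 Non-constancy is inherited by finer averages -/

section Inherit

/-- **If `A_{C'} G` is non-constant and `C ⊆ C'`, then `A_C G` is non-constant** (continuous `G`):
were `A_C G` constant, `A_{C'} G = A_{C'}(A_C G)` would be constant too. -/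
theorem exists_ne_coordAvg_of_subset {C C' : Finset ι} (hCC' : C ⊆ C') {G : (ι → X) → ℝ}
    (hG : Continuous G) {ω₁ ω₂ : ι → X} (hne : coordAvg μ C' G ω₁ ≠ coordAvg μ C' G ω₂) :
    ∃ η₁ η₂ : ι → X, coordAvg μ C G η₁ ≠ coordAvg μ C G η₂ := by
  by_contra h
  push Not at h
  -- `A_C G` is the constant `k = A_C G ω₁`
  have hconst : coordAvg μ C G = fun _ => coordAvg μ C G ω₁ := funext fun η => h η ω₁
  have h1 := coordAvg_coordAvg_of_subset μ hCC' hG ω₁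
  have h2 := coordAvg_coordAvg_of_subset μ hCC' hG ω₂
  rw [hconst, coordAvg_const] at h1 h2
  exact hne (h1.symm.trans h2)

end Inherit

/-! ## §3 Averaging decreases the variance -/

section Variance

/-- **`Var(A_{C'} G) ≤ Var(A_C G)` for `C ⊆ C'`** (continuous `G`; both have mean `∫G dπ`): by the
tower property and Jensen, `(A_{C'} G − m)² = (A_{C'}(A_C G − m))² ≤ A_{C'}((A_C G − m)²)`, and
`A_{C'}` preserves means. -/
theorem variance_coordAvg_le_of_subset {C C' : Finset ι} (hCC' : C ⊆ C') {G : (ι → X) → ℝ}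
    (hG : Continuous G) :
    ∫ ω, (coordAvg μ C' G ω - ∫ ω', G ω' ∂Measure.pi (fun _ : ι => μ)) ^ 2 ∂Measure.pi (fun _ : ι => μ) ≤
      ∫ ω, (coordAvg μ C G ω - ∫ ω', G ω' ∂Measure.pi (fun _ : ι => μ)) ^ 2
        ∂Measure.pi (fun _ : ι => μ) := by
  set m : ℝ := ∫ ω', G ω' ∂Measure.pi (fun _ : ι => μ) with hm
  have hAC : Continuous (coordAvg μ C G) := continuous_coordAvg μ C hG
  have hH : Continuous fun ω => coordAvg μ C G ω - m := hAC.sub continuous_const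
  -- tower: `A_{C'} G − m = A_{C'}(A_C G − m)`
  have htower : ∀ ω, coordAvg μ C' G ω - m = coordAvg μ C' (fun ω => coordAvg μ C G ω - m) ω := by
    intro ω
    rw [coordAvg_sub μ C' hAC continuous_const, coordAvg_const, coordAvg_coordAvg_of_subset μ hCC' hG]
  -- Jensen pointwise, then integrate; `A_{C'}` preserves the mean of `(A_C G − m)²`
  have hJ : ∀ ω, (coordAvg μ C' G ω - m) ^ 2 ≤ coordAvg μ C' (fun ω => (coordAvg μ C G ω - m) ^ 2) ω := by
    intro ω
    rw [htower ω]
    exact sq_coordAvg_le μ C' hH ω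
  calc ∫ ω, (coordAvg μ C' G ω - m) ^ 2 ∂Measure.pi (fun _ : ι => μ)
      ≤ ∫ ω, coordAvg μ C' (fun ω => (coordAvg μ C G ω - m) ^ 2) ω ∂Measure.pi (fun _ : ι => μ) :=
        integral_mono (integrable_pi_of_continuous μ ((continuous_coordAvg μ C' hG).sub continuous_const
          |>.pow 2)) (integrable_pi_of_continuous μ (continuous_coordAvg μ C' (hH.pow 2))) hJ
    _ = ∫ ω, (coordAvg μ C G ω - m) ^ 2 ∂Measure.pi (fun _ : ι => μ) := integral_coordAvg μ C' (hH.pow 2)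

/-- In particular **`Var(A_C G) ≤ Var(G)`**: coordinate averaging can only decrease the variance. -/
theorem variance_coordAvg_le {C : Finset ι} {G : (ι → X) → ℝ} (hG : Continuous G) :
    ∫ ω, (coordAvg μ C G ω - ∫ ω', G ω' ∂Measure.pi (fun _ : ι => μ)) ^ 2 ∂Measure.pi (fun _ : ι => μ) ≤
      ∫ ω, (G ω - ∫ ω', G ω' ∂Measure.pi (fun _ : ι => μ)) ^ 2 ∂Measure.pi (fun _ : ι => μ) := by
  have h := variance_coordAvg_le_of_subset μ (Finset.empty_subset C) hG
  simpa only [coordAvg_empty] using h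

end Variance

end Summit.Ventures.LatticeQCDFlow.Exactness

end
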